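import Literature.MathematicalPhysics.QuantumFieldTheory.Balaban1983to89.B8Eq106Local
import Literature.MathematicalPhysics.QuantumFieldTheory.Balaban1983to89.B8Eq1112Quotient
import Literature.MathematicalPhysics.QuantumFieldTheory.Balaban1983to89.B8Prop7AdmittedFamily

/-!
# `Balaban1983to89.B8Eq1112Local` — T. Bałaban, *Spaces of regular gauge field configurations on a lattice and gauge fixing
# conditions*, Commun. Math. Phys. **99** (1985) 75–102 [Balaban1985RegularSpaces] ("B8"), proof of Theorem 4, (1.112) p. 95: «u′ = u₂u₁⁻¹
# satisfies the regularity conditions (1.73), (1.74) with k instead of k − 1 and with a worse constant. This follows from Proposition 8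
# of [3]» — ON THE BLOCK TOWER `Bʲ(y)` FOR TWO SOLUTIONS OF THE MULTI-DOMAIN GAUGE-FIXING PROBLEM (local hypotheses, unitary values)

statement-level skeleton of published theorems with citation tags; proofs where landed; nothing here is a claim about the
Yang–Mills mass gap

PDF held: `paper:balaban1985-cmp99-regular-spaces-gauge-fixing` (journal page = PDF page + 74); p. 95 [PDF 21] on the text layer and the
x2 render (this seat, 2026-08-25); [3] = [Balaban1985Averaging] Proposition 8 p. 45 as quoted and proved in `B7Prop8PrintedConstants` /
`B8Eq1112Quotient`.

WHAT IS PRINTED (p. 95, verbatim): "Now if `u₁, u₂` are two solutions of the problem described in this theorem, then the configurations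
`U₁ = U′₁^{u₁⁻¹}`, `U₂ = U′₁^{u₂⁻¹}` satisfy the conditions of the theorem, especially the bounds (1.62). This implies that `u′ = u₂u₁⁻¹`
satisfies the regularity conditions (1.73), (1.74) with `k` instead of `k − 1` and with a worse constant. This follows from Proposition 8
of [3]. For `α₀ + α₁` sufficiently small the assumptions of this proposition are satisfied … (1.112)".

WHY THIS FILE.  `B8Eq1112Quotient.eq1112_quotient` proves the sentence on the concrete `ℤᵈ` carriers from GLOBAL memberships
`u₁, u₂ ∈ Λ_k(U₀, α₃)` ((166)–(167) everywhere).  For B8's multi-domain problem the two solutions satisfy (1.73)/(1.74) only on the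
towers `Bʲ(Λ_j)` (`B8Eq106Local`: each `uᵢ` is «given by (106)» for its own `Uᵢ = U′^{uᵢ⁻¹}` there).  THIS FILE proves the sentence ON THE
TOWER from tower data only.  Device (the tree's): both solutions have canonical GLOBAL extensions — the gauge fixings
`glev(π^*U₀, π^*Uᵢ)` of the CLAMPED pair, which are unitary-valued (`B8Prop7AdmittedFamily.glev_mem_unitaryUnits`) and lie in
`Λ_j(π^*U₀, α₃)` globally (`B7Eq167General.inLambda_glev_general`); Proposition 8 of [3] applies to them (`eq1112_quotient`, levels
unitary by `B7Prop2Explicit.prop2_unitaryUnits`), and the conclusion is read back on the tower through the locality of the averages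
(`B8Ineq172Concrete.uavg_congr_tower` / `expr167_congr_tower`).

WHAT THIS FILE PROVES (kernel, 0 sorry, theorems only, no `def`; `𝔸` a nontrivial C⋆-algebra — print's `G ⊂ U(N)` — `d ≥ 1`; tower
`[tlo L y n, thi L y n]` of `B8Ineq130`, `lo = hi = y`; `α₃ = 40d·c`, `c = B₁(α₀ + α₁)`, `C₃ = 1116`).
* §1 device lemmas (private): the clamp is multiplicative, `π^*(e^{B}) = e^{B^π}` with `|B^π| ≤` the box bound of `B`.
* §2 `glev_clamp_unitary_inLambda` — one global extension `glev(π^*U₀, π^*e^{B})` is unitary-valued and in `Λ_j(π^*U₀, α₃)`;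
  `inLambda_quotient_glev_clamp` — Proposition 8 of [3] for the two global extensions: `g₂g₁⁻¹ ∈ Λ_j(π^*U₀, 2α₃ + 2C₃α₃²)`.
* §3 **`eq1112_local`** — for two gauge transformations `u₁, u₂`, each bringing its `Uᵢ = e^{Bᵢ}` to the block axial gauge (1.19) on the tower
  under `y` with (1.29) at `y`, with `U₀` unitary-valued and regular on `Bʲ(y)`, `UᵢU₀` regular on `Bʲ(y)` ((1.62)/(1.34)), `|Bᵢ| ≤ cL^{−j}` on
  `Bʲ(y)` ((1.62)/(1.69)), `e^{Bᵢ}` unitary-valued on `Bʲ(y)`, and the `j`-free smallness (that of `B7Eq167General`, `2048·d·c ≤ 1`,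
  `40d·c ≤ 1/3000`): (1.73)-type `‖(\overline{R₀u′}ᵐ)(z) − 1‖ ≤ 2α₃ + 2C₃α₃²` at every tower site and (1.74)-type
  `‖(\overline{R₀u′}ᵐ)(x_{m+1})⁻¹(R̄ᵐ\overline{R₀u′}ᵐ)(x_m) − 1‖ ≤ (2α₃ + 2C₃α₃²)L^{m+1}L^{−j}` at every tower block, `u′ = u₂u₁⁻¹` — «with k
  instead of k − 1 and with a worse constant».

READINGS / DECLARED DEVIATIONS: `ℤᵈ` per level; `𝔸` a C⋆-algebra, "unitary-valued" = print's compact `G`; explicit constants (`α₃ = 40d·c`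
for print's `16dB₁(α₀ + α₁)`, `C₃ = 1116`, `c₆ = 1/3000` of `B7Prop8PrintedConstants`); `≤` for `<`; the two regularity hypotheses
((52)-type for `U₀` and for `UᵢU₀` on the block) are print's (1.33)/(1.34) resp. (1.62) read on `Bʲ(y)`.  NOT CLAIMED: the rest of the
uniqueness argument (Proposition 5's (1.109), p. 95), anything of Theorem 4.  Unit `pub-ymgap-dag-n04-b` (YM Track A, node N05 [B8]),
2026-08-25.  Tree API by name only, nothing restated.
-/

noncomputable section

open NormedSpace Finset

namespace Literature.MathematicalPhysics.QuantumFieldTheory.Balaban1983to89.B8Eq1112Local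

open B7Prop1Explicit B7Prop2Explicit B7Prop3Flat B7Prop1Local B7Eq92Concrete B7Eq99Concrete B7Eq84Concrete B7Eq167Flat B7Eq167General
open B8Ineq130 (tlo thi tlo_zero thi_zero inBox_of_le)
open B8Ineq132 (Under)
open B8Ineq172Concrete (uavg_congr_tower expr167_congr_tower glev_congr_tower)
open B8Eq106Local (under_iff_tower eq106_local)
open B8Eq1112Quotient (eq1112_quotient)

-- `Site` alone could resolve to the torus sites of `Setup.lean`; re-export the `ℤ^d` sites of `B7Prop1Explicit`.
export B7Prop1Explicit (Site)

variable {d : ℕ}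

/-! ## §1 Device: the clamp is multiplicative; the clamped exponential field -/

section Device

variable {G : Type*} [Group G] {lo hi : Site d}

/-- `π^*(VW) = π^*V · π^*W` (the clamp `B7Prop1Local.clampCfg` is a pointwise operation). [folklore] -/
private theorem clampCfg_mul (V W : Site d → Fin d → G) : clampCfg lo hi (V * W) = clampCfg lo hi V * clampCfg lo hi W := by
  funext x κ
  simp only [clampCfg, Pi.mul_apply]
  split_ifs <;> simp

end Device

section Main

variable {𝔸 : Type*} [CStarAlgebra 𝔸] [Nontrivial 𝔸]
variable {L : ℕ} {j : ℕ} {y : Site d} {U₀ : Site d → Fin d → 𝔸ˣ} {α₀ αP c : ℝ} {B : Site d → Fin d → 𝔸}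

omit [Nontrivial 𝔸] in
/-- `π^*(e^{B}) = e^{B^π}` for the clamped exponent `B^π(x, κ) = B(πx, κ)` on the clamp's bonds, `0` elsewhere. [folklore] -/
private theorem clampCfg_expCfg (lo hi : Site d) (B : Site d → Fin d → 𝔸) :
    clampCfg lo hi (expCfg B) = expCfg (fun x κ => if lo κ ≤ x κ ∧ x κ < hi κ then B (clamp lo hi x) κ else 0) := by
  funext x κ
  simp only [clampCfg, expCfg]
  split_ifs
  · rfl
  · exact (B7Prop8Flat.expUnit_zero (𝔸 := 𝔸)).symm

omit [Nontrivial 𝔸] in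
/-- The clamped exponent inherits the box bound: `‖B^π(x, κ)‖ ≤ b` from `‖B‖ ≤ b` on the bonds of the box (`b ≥ 0`). [folklore] -/
private theorem norm_clampB_le {lo hi : Site d} (hlohi : ∀ i, lo i ≤ hi i) {b : ℝ} (hb : 0 ≤ b)
    (hB : ∀ (x : Site d) (κ : Fin d), InBox lo hi x → InBox lo hi (x + e κ) → ‖B x κ‖ ≤ b) (x : Site d) (κ : Fin d) :
    ‖(fun x κ => if lo κ ≤ x κ ∧ x κ < hi κ then B (clamp lo hi x) κ else 0) x κ‖ ≤ b := by
  by_cases hP : lo κ ≤ x κ ∧ x κ < hi κ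
  · simp only [hP, and_self, if_true]
    have hx := clamp_inBox hlohi x
    have hxe : InBox lo hi (clamp lo hi x + e κ) := by rw [← clamp_add_e_of hP]; exact clamp_inBox hlohi _
    exact hB _ κ hx hxe
  · simp only [hP, if_false, norm_zero]
    exact hb

/-! ## §2 Proposition 8 of [3] for the global extensions of two tower gauge fixings -/

/-- **ONE GLOBAL EXTENSION** (device): for `U₀` unitary-valued and regular on `Bʲ(y)`, `U₁ = e^{B}` unitary-valued with `U₁U₀` regular on `Bʲ(y)`
and `|B| ≤ cL^{−j}` on `Bʲ(y)`, the gauge fixing `g = glev(π^*U₀, π^*U₁) … j 0` of the clamped pair is unitary-valued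
(`B8Prop7AdmittedFamily.glev_mem_unitaryUnits`) and lies in `Λ_j(π^*U₀, 40d·c)` (`B7Eq167General.inLambda_glev_general`).
[cite: Balaban1985RegularSpaces, p.88 (sentence after (1.69)), (1.112) p.95; Balaban1985Averaging, (104)–(106) p.33, (166)–(167) p.44] -/
theorem glev_clamp_unitary_inLambda (hd : 1 ≤ d) (hL : 2 ≤ L) (hU₀ : ∀ x κ, U₀ x κ ∈ unitaryUnits 𝔸)
    (hα : 0 < α₀) (hα3 : C0 d * α₀ ≤ 1 / 3) (hα4 : 4 * α₀ ≤ c2' d L)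
    (h33 : pdevOn (tlo L y j) (thi L y j) U₀ < α₀ * (((L : ℝ) ^ j)⁻¹) ^ 2) (hc : 0 ≤ c)
    (hsmall : Real.exp (4 * (800 * ((d : ℝ) + 1) ^ 2 * ((d : ℝ) + 4)) * α₀) * (1 + 8 * (131072 * ((d : ℝ) + 1) ^ 2) * c) ≤ 2)
    (hc₃ : 2 * c ≤ c3 d L) (hsm : 2048 * (d : ℝ) * c ≤ 1)
    (hαP : 0 < αP) (hαP3 : C0 d * αP ≤ 1 / 3) (hαP2 : 2 * αP ≤ c2' d L) (hL1 : 1 ≤ L)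
    (hBu : ∀ (x : Site d) (κ : Fin d), expCfg B x κ ∈ unitaryUnits 𝔸)
    (h69 : ∀ (x : Site d) (κ : Fin d), InBox (tlo L y j) (thi L y j) x → InBox (tlo L y j) (thi L y j) (x + e κ) →
      ‖B x κ‖ ≤ c * ((L : ℝ) ^ j)⁻¹)
    (hP : pdevOn (tlo L y j) (thi L y j) (expCfg B * U₀) < αP * (((L : ℝ) ^ j)⁻¹) ^ 2) :
    (∀ x, glev L hL1 (clampCfg (tlo L y j) (thi L y j) U₀) (clampCfg (tlo L y j) (thi L y j) (expCfg B)) j 0 x ∈ unitaryUnits 𝔸) ∧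
      InLambda L (clampCfg (tlo L y j) (thi L y j) U₀)
        (glev L hL1 (clampCfg (tlo L y j) (thi L y j) U₀) (clampCfg (tlo L y j) (thi L y j) (expCfg B)) j 0) j (40 * d * c)
        ((L : ℝ) ^ j)⁻¹ := by
  have hlohi : ∀ i, tlo L y j i ≤ thi L y j i := B8Ineq130.tlo_le_thi hL1 le_rfl j
  have hG : AvgClosed d L (unitaryUnits 𝔸) := avgClosed_unitaryUnits d L
  have hUU : ∀ x κ, U₀ x κ ∈ U1 𝔸 := fun x κ => hG.le_U1 (hU₀ x κ)
  have hLr : (1 : ℝ) ≤ L := by exact_mod_cast hL1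
  have hLj : (0 : ℝ) < (L : ℝ) ^ j := by positivity
  have hkey : (L : ℝ) ^ j * (c * ((L : ℝ) ^ j)⁻¹) = c := by field_simp
  have hb : 0 ≤ c * ((L : ℝ) ^ j)⁻¹ := by positivity
  set U₀c := clampCfg (tlo L y j) (thi L y j) U₀ with hU₀c_def
  have hU₀c : ∀ x κ, U₀c x κ ∈ unitaryUnits 𝔸 := clampCfg_mem hU₀
  have h52c : pdev U₀c < α₀ * (((L : ℝ) ^ j)⁻¹) ^ 2 := (pdev_clampCfg_le hlohi hUU).trans_lt h33
  set Bc : Site d → Fin d → 𝔸 := fun x κ => if tlo L y j κ ≤ x κ ∧ x κ < thi L y j κ then B (clamp (tlo L y j) (thi L y j) x) κ else 0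
    with hBc_def
  have hexp : clampCfg (tlo L y j) (thi L y j) (expCfg B) = expCfg Bc := clampCfg_expCfg _ _ B
  have hBc : ∀ x κ, ‖Bc x κ‖ ≤ c * ((L : ℝ) ^ j)⁻¹ := norm_clampB_le hlohi hb h69
  have hBcu : ∀ x κ, expCfg Bc x κ ∈ unitaryUnits 𝔸 := fun x κ => by rw [← hexp]; exact clampCfg_mem hBu x κ
  -- (52) for the clamped product `e^{Bc}·π^*U₀ = π^*(U₁U₀)`
  have hPU : ∀ x κ, (expCfg B * U₀) x κ ∈ U1 𝔸 := fun x κ => by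
    rw [Pi.mul_apply]; exact (U1 𝔸).mul_mem (hG.le_U1 (hBu x κ)) (hUU x κ)
  have hprod : expCfg Bc * U₀c = clampCfg (tlo L y j) (thi L y j) (expCfg B * U₀) := by rw [clampCfg_mul, hexp]
  have hPc : pdev (expCfg Bc * U₀c) < αP * (((L : ℝ) ^ j)⁻¹) ^ 2 := by
    rw [hprod]; exact (pdev_clampCfg_le hlohi hPU).trans_lt hP
  rw [hexp]
  refine ⟨fun x => ?_, ?_⟩
  · exact B8Prop7AdmittedFamily.glev_mem_unitaryUnits hd hL hU₀c hBcu hα hα3 hα4 h52c hb hBc (by rw [hkey]; exact hsmall)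
      (by rw [hkey]; exact hc₃) (by rw [hkey]; exact hsm) hαP hαP3 hαP2 hPc hL1 0 (Nat.zero_le _) x
  · have hs : 128 * (d : ℝ) * ((L : ℝ) ^ j * (c * ((L : ℝ) ^ j)⁻¹)) ≤ 1 := by rw [hkey]; linarith
    have h := inLambda_glev_general hL hG hU₀c hα hα3 hα4 h52c hb hBc (by rw [hkey]; exact hsmall) (by rw [hkey]; exact hc₃) hs hL1
    rwa [hkey] at h

/-- **PROPOSITION 8 OF [3] FOR THE TWO GLOBAL EXTENSIONS**: `g₂g₁⁻¹ ∈ Λ_j(π^*U₀, 2α₃ + 2C₃α₃²)`, `α₃ = 40d·c`, for the gauge fixings `gᵢ` of the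
clamped pairs `(π^*U₀, π^*e^{Bᵢ})` (`glev_clamp_unitary_inLambda`; `B8Eq1112Quotient.eq1112_quotient`, levels unitary by Proposition 2).
[cite: Balaban1985RegularSpaces, (1.112) p.95; Balaban1985Averaging, Proposition 8 p.45] -/
theorem inLambda_quotient_glev_clamp (hd : 1 ≤ d) (hL : 2 ≤ L) (hU₀ : ∀ x κ, U₀ x κ ∈ unitaryUnits 𝔸)
    (hα : 0 < α₀) (hα3 : C0 d * α₀ ≤ 1 / 3) (hα4 : 4 * α₀ ≤ c2' d L)
    (h33 : pdevOn (tlo L y j) (thi L y j) U₀ < α₀ * (((L : ℝ) ^ j)⁻¹) ^ 2) (hc : 0 ≤ c)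
    (hsmall : Real.exp (4 * (800 * ((d : ℝ) + 1) ^ 2 * ((d : ℝ) + 4)) * α₀) * (1 + 8 * (131072 * ((d : ℝ) + 1) ^ 2) * c) ≤ 2)
    (hc₃ : 2 * c ≤ c3 d L) (hsm : 2048 * (d : ℝ) * c ≤ 1) (hα₃ : 40 * d * c ≤ 1 / 3000)
    (hαP : 0 < αP) (hαP3 : C0 d * αP ≤ 1 / 3) (hαP2 : 2 * αP ≤ c2' d L) (hL1 : 1 ≤ L)
    {B₁ B₂ : Site d → Fin d → 𝔸}
    (hBu₁ : ∀ (x : Site d) (κ : Fin d), expCfg B₁ x κ ∈ unitaryUnits 𝔸) (hBu₂ : ∀ (x : Site d) (κ : Fin d), expCfg B₂ x κ ∈ unitaryUnits 𝔸)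
    (h69₁ : ∀ (x : Site d) (κ : Fin d), InBox (tlo L y j) (thi L y j) x → InBox (tlo L y j) (thi L y j) (x + e κ) →
      ‖B₁ x κ‖ ≤ c * ((L : ℝ) ^ j)⁻¹)
    (h69₂ : ∀ (x : Site d) (κ : Fin d), InBox (tlo L y j) (thi L y j) x → InBox (tlo L y j) (thi L y j) (x + e κ) →
      ‖B₂ x κ‖ ≤ c * ((L : ℝ) ^ j)⁻¹)
    (hP₁ : pdevOn (tlo L y j) (thi L y j) (expCfg B₁ * U₀) < αP * (((L : ℝ) ^ j)⁻¹) ^ 2)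
    (hP₂ : pdevOn (tlo L y j) (thi L y j) (expCfg B₂ * U₀) < αP * (((L : ℝ) ^ j)⁻¹) ^ 2) :
    InLambda L (clampCfg (tlo L y j) (thi L y j) U₀)
      (glev L hL1 (clampCfg (tlo L y j) (thi L y j) U₀) (clampCfg (tlo L y j) (thi L y j) (expCfg B₂)) j 0 *
        (glev L hL1 (clampCfg (tlo L y j) (thi L y j) U₀) (clampCfg (tlo L y j) (thi L y j) (expCfg B₁)) j 0)⁻¹)
      j (2 * (40 * d * c) + 2 * 1116 * (40 * d * c) ^ 2) ((L : ℝ) ^ j)⁻¹ := by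
  have hlohi : ∀ i, tlo L y j i ≤ thi L y j i := B8Ineq130.tlo_le_thi hL1 le_rfl j
  have hG : AvgClosed d L (unitaryUnits 𝔸) := avgClosed_unitaryUnits d L
  have hUU : ∀ x κ, U₀ x κ ∈ U1 𝔸 := fun x κ => hG.le_U1 (hU₀ x κ)
  have hLr : (1 : ℝ) ≤ L := by exact_mod_cast hL1
  have hLj : (0 : ℝ) < (L : ℝ) ^ j := by positivity
  have hη : (0 : ℝ) ≤ ((L : ℝ) ^ j)⁻¹ := by positivity
  have hk : (L : ℝ) ^ j * ((L : ℝ) ^ j)⁻¹ ≤ 1 := by rw [mul_inv_cancel₀ hLj.ne']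
  have hU₀c : ∀ x κ, clampCfg (tlo L y j) (thi L y j) U₀ x κ ∈ unitaryUnits 𝔸 := clampCfg_mem hU₀
  have h52c : pdev (clampCfg (tlo L y j) (thi L y j) U₀) < α₀ * (((L : ℝ) ^ j)⁻¹) ^ 2 := (pdev_clampCfg_le hlohi hUU).trans_lt h33
  have hV : ∀ j' < j, ∀ (x : Site d) (κ : Fin d), avgIter L (clampCfg (tlo L y j) (thi L y j) U₀) j' x κ ∈ unitaryUnits 𝔸 :=
    fun j' hj' x κ => (prop2_unitaryUnits L hL j _ hU₀c hα hα3 (by linarith) h52c).2 j' hj'.le x κ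
  obtain ⟨hu₁, hΛ₁⟩ := glev_clamp_unitary_inLambda hd hL hU₀ hα hα3 hα4 h33 hc hsmall hc₃ hsm hαP hαP3 hαP2 hL1 hBu₁ h69₁ hP₁
  obtain ⟨hu₂, hΛ₂⟩ := glev_clamp_unitary_inLambda hd hL hU₀ hα hα3 hα4 h33 hc hsmall hc₃ hsm hαP hαP3 hαP2 hL1 hBu₂ h69₂ hP₂
  exact eq1112_quotient hV hu₁ hu₂ hL hη hk (by positivity) hα₃ hΛ₁ hΛ₂

/-! ## §3 (1.112) on the tower for two solutions -/

/-- **(1.112) ON THE TOWER, LOCAL HYPOTHESES** («u′ = u₂u₁⁻¹ satisfies the regularity conditions (1.73), (1.74) with k instead of k − 1 and with a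
worse constant. This follows from Proposition 8 of [3]»): let `u₁, u₂` be two gauge transformations, `uᵢ` bringing its `Uᵢ = e^{Bᵢ}` to the block
axial gauge (1.19) on the tower under the level-`j` site `y` with (1.29) at `y` (two solutions of the gauge-fixing problem: `U′ = Uᵢ^{uᵢ}`); let
`U₀`, `Uᵢ` be unitary-valued, `U₀` and `UᵢU₀` regular on `Bʲ(y)` ((1.33)/(1.34), (1.62)), `|Bᵢ| ≤ cL^{−j}` on `Bʲ(y)`, with the `j`-free smallness
displayed (`α₃ = 40d·c ≤ 1/3000`, `2048·d·c ≤ 1`, `B7Eq167General`'s list).  Then `u′ = u₂u₁⁻¹` satisfies, with `α₃′ = 2α₃ + 2C₃α₃²`: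
(1.73)-type `‖(\overline{R₀u′}ᵐ)(z) − 1‖ ≤ α₃′` at every level-`m` site `z ∈ Bⁿ(y)` (`n + m = j`), and (1.74)-type
`‖(\overline{R₀u′}ᵐ)(Lz)⁻¹·R(Ū₀ᵐ(Γ_{z,x}))·(\overline{R₀u′}ᵐ)(Lz + r) − 1‖ ≤ α₃′·L^{m+1}·L^{−j}` at every level-`(m+1)` site `z ∈ Bⁿ(y)`
(`n + (m+1) = j`) and block point `r`. [cite: Balaban1985RegularSpaces, (1.112) p.95, (1.73)–(1.74) pp.88–89; Balaban1985Averaging, Proposition 8 p.45, (166)–(167) p.44] -/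
theorem eq1112_local (hd : 1 ≤ d) (hL : 2 ≤ L) (hU₀ : ∀ x κ, U₀ x κ ∈ unitaryUnits 𝔸)
    (hα : 0 < α₀) (hα3 : C0 d * α₀ ≤ 1 / 3) (hα4 : 4 * α₀ ≤ c2' d L)
    (h33 : pdevOn (tlo L y j) (thi L y j) U₀ < α₀ * (((L : ℝ) ^ j)⁻¹) ^ 2) (hc : 0 ≤ c)
    (hsmall : Real.exp (4 * (800 * ((d : ℝ) + 1) ^ 2 * ((d : ℝ) + 4)) * α₀) * (1 + 8 * (131072 * ((d : ℝ) + 1) ^ 2) * c) ≤ 2)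
    (hc₃ : 2 * c ≤ c3 d L) (hsm : 2048 * (d : ℝ) * c ≤ 1) (hα₃ : 40 * d * c ≤ 1 / 3000)
    (hαP : 0 < αP) (hαP3 : C0 d * αP ≤ 1 / 3) (hαP2 : 2 * αP ≤ c2' d L) (hL1 : 1 ≤ L)
    {B₁ B₂ : Site d → Fin d → 𝔸} {u₁ u₂ : Site d → 𝔸ˣ}
    (hBu₁ : ∀ (x : Site d) (κ : Fin d), expCfg B₁ x κ ∈ unitaryUnits 𝔸) (hBu₂ : ∀ (x : Site d) (κ : Fin d), expCfg B₂ x κ ∈ unitaryUnits 𝔸)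
    (h69₁ : ∀ (x : Site d) (κ : Fin d), InBox (tlo L y j) (thi L y j) x → InBox (tlo L y j) (thi L y j) (x + e κ) →
      ‖B₁ x κ‖ ≤ c * ((L : ℝ) ^ j)⁻¹)
    (h69₂ : ∀ (x : Site d) (κ : Fin d), InBox (tlo L y j) (thi L y j) x → InBox (tlo L y j) (thi L y j) (x + e κ) →
      ‖B₂ x κ‖ ≤ c * ((L : ℝ) ^ j)⁻¹)
    (hP₁ : pdevOn (tlo L y j) (thi L y j) (expCfg B₁ * U₀) < αP * (((L : ℝ) ^ j)⁻¹) ^ 2)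
    (hP₂ : pdevOn (tlo L y j) (thi L y j) (expCfg B₂ * U₀) < αP * (((L : ℝ) ^ j)⁻¹) ^ 2)
    (hax₁ : ∀ n, n < j → ∀ z : Site d, Under L (j - (n + 1)) y z → ∀ r : Fin d → Fin L,
      tHol (avgIter L U₀ n) (tildIter L U₀ (mgauge U₀ u₁ (expCfg B₁)) n) ((L : ℤ) • z) (treeWord (boxVec L r)) = 1)
    (hax₂ : ∀ n, n < j → ∀ z : Site d, Under L (j - (n + 1)) y z → ∀ r : Fin d → Fin L,
      tHol (avgIter L U₀ n) (tildIter L U₀ (mgauge U₀ u₂ (expCfg B₂)) n) ((L : ℤ) • z) (treeWord (boxVec L r)) = 1)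
    (h129₁ : uavg L U₀ u₁ j y = 1) (h129₂ : uavg L U₀ u₂ j y = 1) :
    (∀ (m n : ℕ), n + m = j → ∀ z : Site d, tlo L y n ≤ z → z ≤ thi L y n →
        ‖((uavg L U₀ (u₂ * u₁⁻¹) m z : 𝔸ˣ) : 𝔸) - 1‖ ≤ 2 * (40 * d * c) + 2 * 1116 * (40 * d * c) ^ 2) ∧
      ∀ (m n : ℕ), n + (m + 1) = j → ∀ z : Site d, tlo L y n ≤ z → z ≤ thi L y n → ∀ r : Fin d → Fin L,
        ‖((((uavg L U₀ (u₂ * u₁⁻¹) m ((L : ℤ) • z))⁻¹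
            * Rc (hol (avgIter L U₀ m) ((L : ℤ) • z) (treeWord (boxVec L r))) (uavg L U₀ (u₂ * u₁⁻¹) m ((L : ℤ) • z + boxVec L r)) : 𝔸ˣ)) : 𝔸)
            - 1‖ ≤ (2 * (40 * d * c) + 2 * 1116 * (40 * d * c) ^ 2) * (L : ℝ) ^ (m + 1) * ((L : ℝ) ^ j)⁻¹ := by
  obtain ⟨h166, h167⟩ := inLambda_quotient_glev_clamp hd hL hU₀ hα hα3 hα4 h33 hc hsmall hc₃ hsm hα₃ hαP hαP3 hαP2 hL1 hBu₁ hBu₂ h69₁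
    h69₂ hP₁ hP₂
  -- the two solutions agree with the global extensions on the fine tower
  have h₀ : AgreeOn (tlo L y j) (thi L y j) U₀ (clampCfg (tlo L y j) (thi L y j) U₀) := (clampCfg_agree U₀).symm
  have hg : ∀ {Bi : Site d → Fin d → 𝔸} {ui : Site d → 𝔸ˣ},
      (∀ n, n < j → ∀ z : Site d, Under L (j - (n + 1)) y z → ∀ r : Fin d → Fin L,
        tHol (avgIter L U₀ n) (tildIter L U₀ (mgauge U₀ ui (expCfg Bi)) n) ((L : ℤ) • z) (treeWord (boxVec L r)) = 1) →
      uavg L U₀ ui j y = 1 →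
      ∀ x : Site d, tlo L y j ≤ x → x ≤ thi L y j →
        ui x = glev L hL1 (clampCfg (tlo L y j) (thi L y j) U₀) (clampCfg (tlo L y j) (thi L y j) (expCfg Bi)) j 0 x := by
    intro Bi ui hax h129 x hx hx'
    rw [eq106_local L hL1 U₀ (expCfg Bi) ui j y hax h129 x ((under_iff_tower L j y x).2 ⟨hx, hx'⟩)]
    exact glev_congr_tower hL1 h₀ (clampCfg_agree (expCfg Bi)).symm j 0 (by omega) x hx hx'
  have hu : ∀ x : Site d, tlo L y j ≤ x → x ≤ thi L y j →
      (u₂ * u₁⁻¹) x = (glev L hL1 (clampCfg (tlo L y j) (thi L y j) U₀) (clampCfg (tlo L y j) (thi L y j) (expCfg B₂)) j 0 *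
        (glev L hL1 (clampCfg (tlo L y j) (thi L y j) U₀) (clampCfg (tlo L y j) (thi L y j) (expCfg B₁)) j 0)⁻¹) x := by
    intro x hx hx'
    simp only [Pi.mul_apply, Pi.inv_apply, hg hax₁ h129₁ x hx hx', hg hax₂ h129₂ x hx hx']
  refine ⟨fun m n hmn z hz hz' => ?_, fun m n hmn z hz hz' r => ?_⟩
  · rw [uavg_congr_tower hL1 h₀ hu m n hmn z hz hz']
    exact h166 m (by omega) z
  · rw [expr167_congr_tower hL1 h₀ hu hmn hz hz' r]
    have h := h167 m (by omega) z r
    simpa only [mul_assoc] using h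

/-! ## §4 The quotient in the other order (the tree's moving-frame convention) -/

/-- **(1.112) ON THE TOWER FOR `u′ = u₁⁻¹u₂`** — the order of the quotient in the tree's convention of the action (55)/(1.17)
(`B7Eq106Concrete.mgauge_mgauge`: `U′ = U₁^{u₁} = U₂^{u₂}` gives `U₂ = U₁^{u₂⁻¹u₁}`, i.e. `U₁^{u′⁻¹} = U₂` with `u′ = u₁⁻¹u₂`): under the data of
`eq1112_local`, `u′ = u₁⁻¹u₂` satisfies the same (1.73)/(1.74)-type bounds on the tower (Proposition 8 of [3] for `u₁⁻¹, u₂`, the class being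
inverse-closed — `B8Eq1112Quotient.inLambda_inv`). [cite: Balaban1985RegularSpaces, (1.112) p.95; Balaban1985Averaging, Proposition 8 p.45] -/
theorem eq1112_local_inv_mul (hd : 1 ≤ d) (hL : 2 ≤ L) (hU₀ : ∀ x κ, U₀ x κ ∈ unitaryUnits 𝔸)
    (hα : 0 < α₀) (hα3 : C0 d * α₀ ≤ 1 / 3) (hα4 : 4 * α₀ ≤ c2' d L)
    (h33 : pdevOn (tlo L y j) (thi L y j) U₀ < α₀ * (((L : ℝ) ^ j)⁻¹) ^ 2) (hc : 0 ≤ c)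
    (hsmall : Real.exp (4 * (800 * ((d : ℝ) + 1) ^ 2 * ((d : ℝ) + 4)) * α₀) * (1 + 8 * (131072 * ((d : ℝ) + 1) ^ 2) * c) ≤ 2)
    (hc₃ : 2 * c ≤ c3 d L) (hsm : 2048 * (d : ℝ) * c ≤ 1) (hα₃ : 40 * d * c ≤ 1 / 3000)
    (hαP : 0 < αP) (hαP3 : C0 d * αP ≤ 1 / 3) (hαP2 : 2 * αP ≤ c2' d L) (hL1 : 1 ≤ L)
    {B₁ B₂ : Site d → Fin d → 𝔸} {u₁ u₂ : Site d → 𝔸ˣ}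
    (hBu₁ : ∀ (x : Site d) (κ : Fin d), expCfg B₁ x κ ∈ unitaryUnits 𝔸) (hBu₂ : ∀ (x : Site d) (κ : Fin d), expCfg B₂ x κ ∈ unitaryUnits 𝔸)
    (h69₁ : ∀ (x : Site d) (κ : Fin d), InBox (tlo L y j) (thi L y j) x → InBox (tlo L y j) (thi L y j) (x + e κ) →
      ‖B₁ x κ‖ ≤ c * ((L : ℝ) ^ j)⁻¹)
    (h69₂ : ∀ (x : Site d) (κ : Fin d), InBox (tlo L y j) (thi L y j) x → InBox (tlo L y j) (thi L y j) (x + e κ) →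
      ‖B₂ x κ‖ ≤ c * ((L : ℝ) ^ j)⁻¹)
    (hP₁ : pdevOn (tlo L y j) (thi L y j) (expCfg B₁ * U₀) < αP * (((L : ℝ) ^ j)⁻¹) ^ 2)
    (hP₂ : pdevOn (tlo L y j) (thi L y j) (expCfg B₂ * U₀) < αP * (((L : ℝ) ^ j)⁻¹) ^ 2)
    (hax₁ : ∀ n, n < j → ∀ z : Site d, Under L (j - (n + 1)) y z → ∀ r : Fin d → Fin L,
      tHol (avgIter L U₀ n) (tildIter L U₀ (mgauge U₀ u₁ (expCfg B₁)) n) ((L : ℤ) • z) (treeWord (boxVec L r)) = 1)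
    (hax₂ : ∀ n, n < j → ∀ z : Site d, Under L (j - (n + 1)) y z → ∀ r : Fin d → Fin L,
      tHol (avgIter L U₀ n) (tildIter L U₀ (mgauge U₀ u₂ (expCfg B₂)) n) ((L : ℤ) • z) (treeWord (boxVec L r)) = 1)
    (h129₁ : uavg L U₀ u₁ j y = 1) (h129₂ : uavg L U₀ u₂ j y = 1) :
    (∀ (m n : ℕ), n + m = j → ∀ z : Site d, tlo L y n ≤ z → z ≤ thi L y n →
        ‖((uavg L U₀ (u₁⁻¹ * u₂) m z : 𝔸ˣ) : 𝔸) - 1‖ ≤ 2 * (40 * d * c) + 2 * 1116 * (40 * d * c) ^ 2) ∧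
      ∀ (m n : ℕ), n + (m + 1) = j → ∀ z : Site d, tlo L y n ≤ z → z ≤ thi L y n → ∀ r : Fin d → Fin L,
        ‖((((uavg L U₀ (u₁⁻¹ * u₂) m ((L : ℤ) • z))⁻¹
            * Rc (hol (avgIter L U₀ m) ((L : ℤ) • z) (treeWord (boxVec L r))) (uavg L U₀ (u₁⁻¹ * u₂) m ((L : ℤ) • z + boxVec L r)) : 𝔸ˣ)) : 𝔸)
            - 1‖ ≤ (2 * (40 * d * c) + 2 * 1116 * (40 * d * c) ^ 2) * (L : ℝ) ^ (m + 1) * ((L : ℝ) ^ j)⁻¹ := by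
  have hlohi : ∀ i, tlo L y j i ≤ thi L y j i := B8Ineq130.tlo_le_thi hL1 le_rfl j
  have hG : AvgClosed d L (unitaryUnits 𝔸) := avgClosed_unitaryUnits d L
  have hUU : ∀ x κ, U₀ x κ ∈ U1 𝔸 := fun x κ => hG.le_U1 (hU₀ x κ)
  have hLr : (1 : ℝ) ≤ L := by exact_mod_cast hL1
  have hLj : (0 : ℝ) < (L : ℝ) ^ j := by positivity
  have hη : (0 : ℝ) ≤ ((L : ℝ) ^ j)⁻¹ := by positivity
  have hk : (L : ℝ) ^ j * ((L : ℝ) ^ j)⁻¹ ≤ 1 := by rw [mul_inv_cancel₀ hLj.ne']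
  have hU₀c : ∀ x κ, clampCfg (tlo L y j) (thi L y j) U₀ x κ ∈ unitaryUnits 𝔸 := clampCfg_mem hU₀
  have h52c : pdev (clampCfg (tlo L y j) (thi L y j) U₀) < α₀ * (((L : ℝ) ^ j)⁻¹) ^ 2 := (pdev_clampCfg_le hlohi hUU).trans_lt h33
  have hV : ∀ j' < j, ∀ (x : Site d) (κ : Fin d), avgIter L (clampCfg (tlo L y j) (thi L y j) U₀) j' x κ ∈ unitaryUnits 𝔸 :=
    fun j' hj' x κ => (prop2_unitaryUnits L hL j _ hU₀c hα hα3 (by linarith) h52c).2 j' hj'.le x κ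
  obtain ⟨hu₁, hΛ₁⟩ := glev_clamp_unitary_inLambda hd hL hU₀ hα hα3 hα4 h33 hc hsmall hc₃ hsm hαP hαP3 hαP2 hL1 hBu₁ h69₁ hP₁
  obtain ⟨hu₂, hΛ₂⟩ := glev_clamp_unitary_inLambda hd hL hU₀ hα hα3 hα4 h33 hc hsmall hc₃ hsm hαP hαP3 hαP2 hL1 hBu₂ h69₂ hP₂
  -- Proposition 8 for `g₁⁻¹, g₂` (inverse-closure of the class)
  have hs4 : 40 * d * c * (L : ℝ) ^ j * ((L : ℝ) ^ j)⁻¹ ≤ 1 / 4 := by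
    rw [mul_assoc, mul_inv_cancel₀ hLj.ne', mul_one]; linarith
  have hΛ₁' := B8Eq1112Quotient.inLambda_inv hV hu₁ hΛ₁ hL1 hη (by positivity) hs4
  have hu₁' : ∀ x, (glev L hL1 (clampCfg (tlo L y j) (thi L y j) U₀) (clampCfg (tlo L y j) (thi L y j) (expCfg B₁)) j 0)⁻¹ x ∈
      unitaryUnits 𝔸 := fun x => by rw [Pi.inv_apply]; exact (unitaryUnits 𝔸).inv_mem (hu₁ x)
  obtain ⟨h166, h167⟩ := B7Prop8PrintedConstants.prop8_printed hV hu₁' hu₂ hL hη hk (by positivity) hα₃ hΛ₁' hΛ₂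
  -- the two solutions agree with the global extensions on the fine tower
  have h₀ : AgreeOn (tlo L y j) (thi L y j) U₀ (clampCfg (tlo L y j) (thi L y j) U₀) := (clampCfg_agree U₀).symm
  have hg : ∀ {Bi : Site d → Fin d → 𝔸} {ui : Site d → 𝔸ˣ},
      (∀ n, n < j → ∀ z : Site d, Under L (j - (n + 1)) y z → ∀ r : Fin d → Fin L,
        tHol (avgIter L U₀ n) (tildIter L U₀ (mgauge U₀ ui (expCfg Bi)) n) ((L : ℤ) • z) (treeWord (boxVec L r)) = 1) →
      uavg L U₀ ui j y = 1 →
      ∀ x : Site d, tlo L y j ≤ x → x ≤ thi L y j →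
        ui x = glev L hL1 (clampCfg (tlo L y j) (thi L y j) U₀) (clampCfg (tlo L y j) (thi L y j) (expCfg Bi)) j 0 x := by
    intro Bi ui hax h129 x hx hx'
    rw [eq106_local L hL1 U₀ (expCfg Bi) ui j y hax h129 x ((under_iff_tower L j y x).2 ⟨hx, hx'⟩)]
    exact glev_congr_tower hL1 h₀ (clampCfg_agree (expCfg Bi)).symm j 0 (by omega) x hx hx'
  have hu : ∀ x : Site d, tlo L y j ≤ x → x ≤ thi L y j →
      (u₁⁻¹ * u₂) x = ((glev L hL1 (clampCfg (tlo L y j) (thi L y j) U₀) (clampCfg (tlo L y j) (thi L y j) (expCfg B₁)) j 0)⁻¹ *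
        glev L hL1 (clampCfg (tlo L y j) (thi L y j) U₀) (clampCfg (tlo L y j) (thi L y j) (expCfg B₂)) j 0) x := by
    intro x hx hx'
    simp only [Pi.mul_apply, Pi.inv_apply, hg hax₁ h129₁ x hx hx', hg hax₂ h129₂ x hx hx']
  refine ⟨fun m n hmn z hz hz' => ?_, fun m n hmn z hz hz' r => ?_⟩
  · rw [uavg_congr_tower hL1 h₀ hu m n hmn z hz hz']
    exact h166 m (by omega) z
  · rw [expr167_congr_tower hL1 h₀ hu hmn hz hz' r]
    have h := h167 m (by omega) z r
    simpa only [mul_assoc] using h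

end Main

end Literature.MathematicalPhysics.QuantumFieldTheory.Balaban1983to89.B8Eq1112Local

end
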